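import Summits.QuantumFields.GaugeBoot.ZdCovariantLinkRP
import Summits.QuantumFields.GaugeBoot.ClassBHalfWords
import Summits.QuantumFields.GaugeBoot.ZdWordLinkReflection
import Summits.QuantumFields.GaugeBoot.WordLoopZdLimit
import HarnessLib

/-!
# The Kazakov–Zheng cut-loop `R_link` blocks of a covariantly link-RP state, indexed by half-WORDS,
are positive semidefinite (gauge-boot, Class-B brick)

HONEST FRAMING (cell `pub-gaugeboot`, page 1 of every file): the venture produces certified bounds
on lattice expectations at stated coupling, gauge group, dimension and torus size; NOT a mass gap,
NOT a continuum limit, NOT a string tension; NOT Yang–Mills-summit-bearing (barriers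
`FixedCouplingUltralocality`, `PerturbativeInvisibility`). Structural bookkeeping (which SDP blocks
are exact for which states); certifies no number.

## Content

`ClassBDiagonalWordBlocks.lean` / `ClassBSiteWordBlocks.lean` proved the `R_diag` / `R_site`
word blocks of a Class-B state from the corresponding PLAIN reflection-positivity axiom: those
mirrors pass through lattice SITES, so the blocks are indexed by open Wilson lines between mirror
sites and glued at sites. The LINK mirror `x_i = ½` contains no site; Kazakov–Zheng's link-type
positivity matrices (arXiv:2203.11360 §3.1) are indexed by Wilson paths `O_a` running in the closed
half `{x_i ≥ 1}` from `p + e_i` to `q + e_i` (`p, q` in the layer `x_i = 0`) and glued THROUGH THE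
CROSSING LINKS `c_p = (p, i)`, `c_q = (q, i)` into the single loops
`E_ab = [+e_i] · O_b · [-e_i] · (flip_i O_a)⁻¹` based at `p`, with holonomy
`U_{c_p} · hol(O_b)(U) · U_{c_q}⁻¹ · (hol(O_a)(Θ_i U))⁻¹` (`wordHolonomyZd_linkCutGlue`). Their
positivity is NOT a consequence of plain link RP; it is exactly what the COVARIANT property
`IsCovariantLinkRP i μ` of `ZdCovariantLinkRP.lean` delivers, with the coefficient observables
`g_{mk}(V) = Σ_b c_b σ(V_{c_p} · hol(O_b)(V) · V_{c_q}⁻¹)_{mk}` (`σ` the unitarisation of `τ`):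

* `zdLinkReflect_applyZd`, `Word.endpointZd_map_flipAt_link`, `zdLinkReflect_add_single_of_apply_eq_zero`
  — the link mirror on steps, words and the two layers next to it;
* `wordHolonomyZd_linkCutGlue` — the holonomy of the cut-glued loop;
* `trace_linkCutGlue_configCrossTranslate` — **the covariance identity**: after the substitution
  `U_c ↦ U_c Y_c`, `tr τ(hol_p(E_ab)) = tr τ(G_b(splice_C(U, Y)) · G_a(Θ_i U)⁻¹)` with
  `G_a(V) = V_{c_p} hol(O_a)(V) V_{c_q}⁻¹` (conjugation by `U_{c_p}`; the word version of the tree's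
  `trace_rectangleHolonomy_translate` / lean1's `WordLinkRP`);
* ★★★ **`sum_conj_mul_integral_trace_linkCutGlue_nonneg`** — `μ` a finite measure with
  `IsCovariantLinkRP i μ`; `p_i = q_i = 0`; half-words `O_a : p + e_i → q + e_i` whose holonomies
  depend only on `linkHalfEdges i`; `τ` continuous; `c ∈ ℂ^n`:
  `0 ≤ Σ_{ab} c̄_a c_b ∫ tr τ(hol_p(E_ab)) dμ`;
* ★★★ **`rLinkCutWordBlock_nonneg`** — the same in the certificate normalisation
  `wordLoopZd ρ = (1/N) Re tr ρ` with real coefficients, for a probability measure.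

Sequel `ClassBLimitLinkCutWordBlocks.lean`: every infinite-volume torus limit point qualifies
(`covariantLinkRP_of_mem_infiniteVolumeLimitPoints`), with a `decide`-able half-word criterion.
Nothing is claimed for a general `ClassBState`. [folklore] mechanism (Osterwalder–Seiler 1978 §2).
-/

open MeasureTheory Complex Finset Function
open scoped ComplexOrder ComplexConjugate

namespace Summit.QuantumFields.GaugeBoot

open Literature.MathematicalPhysics.QuantumFieldTheory (WilsonRP.EntryMeasurable
  WilsonRP.entryMeasurable_apply WilsonRP.entryMeasurable_apply_inv)
open Literature.MathematicalPhysics.QuantumLattice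
open Literature.RepresentationTheory.CompactGroups

noncomputable section

/-! ## Geometry of the link mirror on words -/

section Geometry

variable {d : ℕ}

/-- The link reflection on steps: `θ_i(x ± e_k) = θ_i x ± e_k` (`k ≠ i`), `θ_i(x ± e_i) = θ_i x ∓ e_i`
(as for the site reflection, from which it differs by a translation). -/
theorem zdLinkReflect_applyZd (i : Fin d) (x : Fin d → ℤ) (s : Step d) :
    zdLinkReflect i (s.applyZd x) = (s.flipAt i).applyZd (zdLinkReflect i x) := by
  rw [zdLinkReflect_eq_zdSiteReflect_add, zdLinkReflect_eq_zdSiteReflect_add, zdSiteReflect_applyZd]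
  generalize s.flipAt i = t
  cases t with
  | fwd μ => simp only [Step.applyZd_fwd]; abel
  | bwd μ => simp only [Step.applyZd_bwd]; abel

/-- Endpoints of reflected words: `end_{θ_i x}(flip_i w) = θ_i (end_x w)` for the link reflection. -/
theorem Word.endpointZd_map_flipAt_link (i : Fin d) :
    ∀ (x : Fin d → ℤ) (w : Word d),
      Word.endpointZd (zdLinkReflect i x) (w.map (Step.flipAt i)) =
        zdLinkReflect i (Word.endpointZd x w)
  | x, [] => rfl
  | x, s :: w => by
    rw [List.map_cons, Word.endpointZd_cons, Word.endpointZd_cons, ← zdLinkReflect_applyZd,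
      Word.endpointZd_map_flipAt_link i (s.applyZd x) w]

/-- The layer `x_i = 1` reflects onto the layer `x_i = 0`: `θ_i (p + e_i) = p` for `p_i = 0`. -/
theorem zdLinkReflect_add_single_of_apply_eq_zero {i : Fin d} {p : Fin d → ℤ} (hp : p i = 0) :
    zdLinkReflect i (p + Pi.single i 1) = p := by
  ext k
  by_cases hk : k = i
  · subst hk; simp [zdLinkReflect, hp]
  · simp [zdLinkReflect, hk]

/-- A crossing link: `(p, i)` with `p_i = 0`. -/
theorem mem_linkCrossEdges_of_apply_eq_zero {i : Fin d} {p : Fin d → ℤ} (hp : p i = 0) :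
    ((p, i) : ZdEdge d) ∈ linkCrossEdges i := ⟨rfl, hp⟩

variable {G : Type*} [Group G]

/-- **The holonomy of the cut-glued loop** `E_ab = [+e_i] · O_b · [-e_i] · (flip_i O_a)⁻¹` at
`p` (`p_i = q_i = 0`; `O_a, O_b : p + e_i → q + e_i`):
`hol_p(E_ab)(U) = U_{(p,i)} · hol_{p+e_i}(O_b)(U) · U_{(q,i)}⁻¹ · (hol_{p+e_i}(O_a)(Θ_i U))⁻¹`. -/
theorem wordHolonomyZd_linkCutGlue [MeasurableSpace G] {i : Fin d} {p q : Fin d → ℤ}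
    (hp : p i = 0) (hq : q i = 0) (U : LGConfig d G) {Oa Ob : Word d}
    (ha : Word.endpointZd (p + Pi.single i 1) Oa = q + Pi.single i 1)
    (hb : Word.endpointZd (p + Pi.single i 1) Ob = q + Pi.single i 1) :
    wordHolonomyZd U p (Step.fwd i :: (Ob ++ Step.bwd i :: Word.reverse (Oa.map (Step.flipAt i)))) =
      U (p, i) * wordHolonomyZd U (p + Pi.single i 1) Ob * (U (q, i))⁻¹ *
        (wordHolonomyZd (configLinkReflect i U) (p + Pi.single i 1) Oa)⁻¹ := by
  have hend : Word.endpointZd p (Oa.map (Step.flipAt i)) = q := by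
    have h := Word.endpointZd_map_flipAt_link i (p + Pi.single i 1) Oa
    rw [zdLinkReflect_add_single_of_apply_eq_zero hp, ha,
      zdLinkReflect_add_single_of_apply_eq_zero hq] at h
    exact h
  have hrev : wordHolonomyZd U q (Word.reverse (Oa.map (Step.flipAt i))) =
      (wordHolonomyZd U p (Oa.map (Step.flipAt i)))⁻¹ := by
    rw [← hend]
    exact wordHolonomyZd_reverse U p _
  have hflip : wordHolonomyZd U p (Oa.map (Step.flipAt i)) =
      wordHolonomyZd (configLinkReflect i U) (p + Pi.single i 1) Oa := by
    rw [wordHolonomyZd_configLinkReflect, zdLinkReflect_add_single_of_apply_eq_zero hp]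
  rw [wordHolonomyZd_cons, stepHolonomyZd_fwd, Step.applyZd_fwd, wordHolonomyZd_append, hb,
    wordHolonomyZd_cons, stepHolonomyZd_bwd, Step.applyZd_bwd, add_sub_cancel_right, hrev, hflip]
  simp only [mul_assoc]

/-- **The covariance identity in the group.** After the substitution `T_Y` the cut-glued holonomy
is conjugate (by `U_{(p,i)}`) to `G_b(splice_C(U, Y)) · G_a(Θ_i U)⁻¹`,
`G_a(V) = V_{(p,i)} · hol_{p+e_i}(O_a)(V) · V_{(q,i)}⁻¹`, for half-words `O_a, O_b` (holonomies
supported in `linkHalfEdges i`). -/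
theorem wordHolonomyZd_linkCutGlue_configCrossTranslate [MeasurableSpace G] {i : Fin d}
    {p q : Fin d → ℤ} (hp : p i = 0) (hq : q i = 0) (U Y : LGConfig d G) {Oa Ob : Word d}
    (ha : Word.endpointZd (p + Pi.single i 1) Oa = q + Pi.single i 1)
    (hb : Word.endpointZd (p + Pi.single i 1) Ob = q + Pi.single i 1)
    (hha : DependsOn (fun V : LGConfig d G => wordHolonomyZd V (p + Pi.single i 1) Oa) (linkHalfEdges i))
    (hhb : DependsOn (fun V : LGConfig d G => wordHolonomyZd V (p + Pi.single i 1) Ob) (linkHalfEdges i)) :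
    wordHolonomyZd (configCrossTranslate i Y U) p
        (Step.fwd i :: (Ob ++ Step.bwd i :: Word.reverse (Oa.map (Step.flipAt i)))) =
      U (p, i) *
        ((configCrossSplice i U Y (p, i) * wordHolonomyZd (configCrossSplice i U Y) (p + Pi.single i 1) Ob *
            (configCrossSplice i U Y (q, i))⁻¹) *
          (configLinkReflect i U (p, i) * wordHolonomyZd (configLinkReflect i U) (p + Pi.single i 1) Oa *
            (configLinkReflect i U (q, i))⁻¹)⁻¹) * (U (p, i))⁻¹ := by
  have hS : ∀ e ∈ linkHalfEdges (d := d) i, e ∉ linkCrossEdges i :=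
    fun e he => not_mem_linkCrossEdges_of_mem_linkHalfEdges he
  have hpc := mem_linkCrossEdges_of_apply_eq_zero (d := d) hp
  have hqc := mem_linkCrossEdges_of_apply_eq_zero (d := d) hq
  rw [wordHolonomyZd_linkCutGlue hp hq _ ha hb, configCrossTranslate_apply_of_mem Y U hpc,
    configCrossTranslate_apply_of_mem Y U hqc, apply_configCrossTranslate_eq hhb hS,
    apply_configLinkReflect_configCrossTranslate_eq hha hS, configCrossSplice_apply_of_mem U Y hpc,
    configCrossSplice_apply_of_mem U Y hqc, apply_configCrossSplice_eq hhb hS,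
    configLinkReflect_apply_of_mem_linkCrossEdges U hpc, configLinkReflect_apply_of_mem_linkCrossEdges U hqc]
  group

end Geometry

/-! ## The blocks -/

section Blocks

variable {d N M : ℕ} {G : Type*} [Group G] [TopologicalSpace G] [IsTopologicalGroup G]
  [CompactSpace G] [MeasurableSpace G] [BorelSpace G] (ρ : G →* Matrix (Fin N) (Fin N) ℂ)
  (τ : G →* Matrix (Fin M) (Fin M) ℂ)

omit [TopologicalSpace G] [IsTopologicalGroup G] [CompactSpace G] [MeasurableSpace G]
  [BorelSpace G] in
/-- Traces of a representation are conjugation invariant. -/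
theorem trace_rep_conj (g x : G) : (τ (g * x * g⁻¹)).trace = (τ x).trace := by
  rw [map_mul, map_mul, Matrix.trace_mul_cycle, ← map_mul, inv_mul_cancel, map_one, Matrix.one_mul]

omit [BorelSpace G] in
/-- **The covariance identity for traces**: after `T_Y`,
`tr τ(hol_p(E_ab)) = Σ_{mk} σ(G_b(splice_C(U,Y)))_{mk} · conj σ(G_a(Θ_i U))_{mk}` (`σ = unitarize τ`). -/
theorem trace_linkCutGlue_configCrossTranslate (hτ : Continuous τ) {i : Fin d} {p q : Fin d → ℤ}
    (hp : p i = 0) (hq : q i = 0) (U Y : LGConfig d G) {Oa Ob : Word d}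
    (ha : Word.endpointZd (p + Pi.single i 1) Oa = q + Pi.single i 1)
    (hb : Word.endpointZd (p + Pi.single i 1) Ob = q + Pi.single i 1)
    (hha : DependsOn (fun V : LGConfig d G => wordHolonomyZd V (p + Pi.single i 1) Oa) (linkHalfEdges i))
    (hhb : DependsOn (fun V : LGConfig d G => wordHolonomyZd V (p + Pi.single i 1) Ob) (linkHalfEdges i)) :
    (τ (wordHolonomyZd (configCrossTranslate i Y U) p
        (Step.fwd i :: (Ob ++ Step.bwd i :: Word.reverse (Oa.map (Step.flipAt i)))))).trace =
      ∑ m, ∑ k, CompactGroup.unitarize τ hτ (configCrossSplice i U Y (p, i) *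
            wordHolonomyZd (configCrossSplice i U Y) (p + Pi.single i 1) Ob *
            (configCrossSplice i U Y (q, i))⁻¹) m k *
          conj (CompactGroup.unitarize τ hτ (configLinkReflect i U (p, i) *
            wordHolonomyZd (configLinkReflect i U) (p + Pi.single i 1) Oa *
            (configLinkReflect i U (q, i))⁻¹) m k) := by
  rw [wordHolonomyZd_linkCutGlue_configCrossTranslate hp hq U Y ha hb hha hhb, trace_rep_conj,
    trace_mul_inv_eq_sum_unitarize τ hτ]

/-- ★★★ **Cut-loop `R_link` blocks of a covariantly link-RP state are PSD — glued-loop trace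
entries, every representation.** `μ` a finite measure on `LGConfig d G` with `IsCovariantLinkRP i μ`;
sites `p, q` of the layer `x_i = 0`; words `O_a : p + e_i → q + e_i` whose holonomies depend only on
`linkHalfEdges i`; `τ` continuous; `c ∈ ℂ^n`. Then
`0 ≤ Σ_{ab} c̄_a c_b ∫ tr τ(hol_p([+e_i] · O_b · [-e_i] · (flip_i O_a)⁻¹)) dμ`. -/
theorem sum_conj_mul_integral_trace_linkCutGlue_nonneg (hτ : Continuous τ)
    {μ : Measure (LGConfig d G)} [IsFiniteMeasure μ] {i : Fin d} (hμ : IsCovariantLinkRP i μ)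
    {p q : Fin d → ℤ} (hp : p i = 0) (hq : q i = 0) {n : ℕ} (O : Fin n → Word d)
    (hend : ∀ a, Word.endpointZd (p + Pi.single i 1) (O a) = q + Pi.single i 1)
    (hhalf : ∀ a, DependsOn (fun U : LGConfig d G => wordHolonomyZd U (p + Pi.single i 1) (O a))
      (linkHalfEdges i))
    (c : Fin n → ℂ) :
    0 ≤ ∑ a, ∑ b, conj (c a) * c b * ∫ U, (τ (wordHolonomyZd U p
      (Step.fwd i :: (O b ++ Step.bwd i :: Word.reverse ((O a).map (Step.flipAt i)))))).trace ∂μ := by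
  classical
  set σ := CompactGroup.unitarize τ hτ with hσ
  have hσc : Continuous σ := CompactGroup.continuous_unitarize τ hτ
  -- the glued words, their traces
  set E : Fin n → Fin n → Word d :=
    fun a b => Step.fwd i :: (O b ++ Step.bwd i :: Word.reverse ((O a).map (Step.flipAt i))) with hE
  have htm : ∀ a b, Measurable fun U : LGConfig d G => (τ (wordHolonomyZd U p (E a b))).trace :=
    fun a b => by
    simp only [Matrix.trace, Matrix.diag_apply]
    exact Finset.measurable_sum _ fun k _ => entryMeasurable_wordHolonomyZd τ hτ (E a b) p k k
  have htb : ∀ g : G, ‖(τ g).trace‖ ≤ M := fun g => by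
    rw [← CompactGroup.trace_unitarize τ hτ g, Matrix.trace]
    calc ‖∑ k, Matrix.diag (CompactGroup.unitarize τ hτ g) k‖
        ≤ ∑ k, ‖Matrix.diag (CompactGroup.unitarize τ hτ g) k‖ := norm_sum_le _ _
      _ ≤ ∑ _k : Fin M, (1 : ℝ) := Finset.sum_le_sum fun k _ => by
          rw [Matrix.diag_apply]; exact CompactGroup.norm_unitarize_apply_le_one τ hτ g k k
      _ = M := by simp
  have hti : ∀ a b, Integrable (fun U : LGConfig d G => (τ (wordHolonomyZd U p (E a b))).trace) μ :=
    fun a b => Integrable.of_bound (htm a b).aestronglyMeasurable (M : ℝ) (ae_of_all _ fun U => htb _)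
  -- the covariant observable `Φ` and its coefficients `g`
  set Φ : LGConfig d G → ℂ :=
    fun U => ∑ a, ∑ b, conj (c a) * c b * (τ (wordHolonomyZd U p (E a b))).trace with hΦ
  set Gf : Fin n → LGConfig d G → G :=
    fun b V => V (p, i) * wordHolonomyZd V (p + Pi.single i 1) (O b) * (V (q, i))⁻¹ with hGf
  set g : Fin M × Fin M → LGConfig d G → ℂ := fun mk V => ∑ b, c b * σ (Gf b V) mk.1 mk.2 with hg
  -- swap sums and integral
  have hswap : ∑ a, ∑ b, conj (c a) * c b * ∫ U, (τ (wordHolonomyZd U p (E a b))).trace ∂μ =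
      ∫ U, Φ U ∂μ := by
    rw [hΦ, integral_finsetSum _ fun a _ => integrable_finsetSum _ fun b _ => (hti a b).const_mul _]
    refine Finset.sum_congr rfl fun a _ => ?_
    rw [integral_finsetSum _ fun b _ => (hti a b).const_mul _]
    exact Finset.sum_congr rfl fun b _ => (integral_const_mul _ _).symm
  rw [hswap]
  -- supports: the half-words are cylinders of the half
  choose S hS using fun b => exists_dependsOn_wordHolonomyZd (G := G) (p + Pi.single i 1) (O b)
  set T : Finset (ZdEdge d) := {((p, i) : ZdEdge d), (q, i)} ∪
    Finset.univ.biUnion fun b => (S b).filter (· ∈ linkHalfEdges (d := d) i) with hT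
  have hTsub : (↑T : Set (ZdEdge d)) ⊆ linkHalfEdges i ∪ linkCrossEdges i := by
    intro e he
    rw [hT, Finset.coe_union] at he
    rcases he with he | he
    · right
      rw [Finset.coe_insert, Finset.coe_singleton] at he
      rcases he with rfl | rfl
      · exact mem_linkCrossEdges_of_apply_eq_zero hp
      · exact mem_linkCrossEdges_of_apply_eq_zero hq
    · left
      rw [Finset.mem_coe, Finset.mem_biUnion] at he
      obtain ⟨b, -, hb⟩ := he
      exact (Finset.mem_filter.1 hb).2
  have hGfT : ∀ b (U V : LGConfig d G), (∀ e ∈ (↑T : Set (ZdEdge d)), U e = V e) → Gf b U = Gf b V := by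
    intro b U V hUV
    have hpi : U (p, i) = V (p, i) := hUV _ (by rw [hT]; simp)
    have hqi : U (q, i) = V (q, i) := hUV _ (by rw [hT]; simp)
    have hcyl : IsCylinder (fun W : LGConfig d G => wordHolonomyZd W (p + Pi.single i 1) (O b))
        ((S b).filter (· ∈ linkHalfEdges (d := d) i)) :=
      isCylinder_filter_of_dependsOn (fun W W' h => hS b W W' h) (hhalf b)
    have hhol : wordHolonomyZd U (p + Pi.single i 1) (O b) = wordHolonomyZd V (p + Pi.single i 1) (O b) :=
      hcyl fun e he => hUV e (by
        rw [hT, Finset.coe_union]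
        refine Or.inr ?_
        rw [Finset.mem_coe, Finset.mem_biUnion]
        exact ⟨b, Finset.mem_univ _, Finset.mem_coe.1 he⟩)
    simp only [hGf, hpi, hqi, hhol]
  have hgT : ∀ mk, IsCylinder (g mk) T := fun mk U V hUV => by
    simp only [hg]
    exact Finset.sum_congr rfl fun b _ => by rw [hGfT b U V hUV]
  have hGfm : ∀ b, WilsonRP.EntryMeasurable σ (Gf b) := fun b =>
    ((WilsonRP.entryMeasurable_apply hσc ((p, i) : ZdEdge d)).mul
      (entryMeasurable_wordHolonomyZd σ hσc (O b) (p + Pi.single i 1))).mul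
      (WilsonRP.entryMeasurable_apply_inv hσc ((q, i) : ZdEdge d))
  have hgm : ∀ mk, Measurable (g mk) := fun mk =>
    Finset.measurable_sum _ fun b _ => (hGfm b mk.1 mk.2).const_mul _
  have hgb : ∃ C : ℝ, ∀ mk U, ‖g mk U‖ ≤ C := by
    refine ⟨∑ b, ‖c b‖, fun mk U => (norm_sum_le _ _).trans (Finset.sum_le_sum fun b _ => ?_)⟩
    rw [norm_mul]
    calc ‖c b‖ * ‖σ (Gf b U) mk.1 mk.2‖ ≤ ‖c b‖ * 1 :=
          mul_le_mul_of_nonneg_left (CompactGroup.norm_unitarize_apply_le_one τ hτ _ _ _) (norm_nonneg _)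
      _ = ‖c b‖ := mul_one _
  -- `Φ` is a bounded continuous cylinder observable
  choose R hR using fun a b => exists_dependsOn_wordHolonomyZd (G := G) p (E a b)
  have hΦS : IsCylinder Φ (Finset.univ.biUnion fun a => Finset.univ.biUnion fun b => R a b) := by
    intro U V hUV
    simp only [hΦ]
    refine Finset.sum_congr rfl fun a _ => Finset.sum_congr rfl fun b _ => ?_
    rw [hR a b U V fun e he => hUV e (by
      rw [Finset.mem_coe, Finset.mem_biUnion]
      exact ⟨a, Finset.mem_univ _, Finset.mem_biUnion.2 ⟨b, Finset.mem_univ _, he⟩⟩)]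
  have hΦc : Continuous Φ :=
    continuous_finsetSum _ fun a _ => continuous_finsetSum _ fun b _ =>
      continuous_const.mul (continuous_trace_wordHolonomyZd τ hτ p (E a b))
  have hΦb : ∃ C : ℝ, ∀ U, ‖Φ U‖ ≤ C := by
    refine ⟨∑ a, ∑ b, ‖c a‖ * ‖c b‖ * M, fun U => (norm_sum_le _ _).trans
      (Finset.sum_le_sum fun a _ => (norm_sum_le _ _).trans (Finset.sum_le_sum fun b _ => ?_))⟩
    rw [norm_mul, norm_mul, Complex.norm_conj]
    exact mul_le_mul_of_nonneg_left (htb _) (mul_nonneg (norm_nonneg _) (norm_nonneg _))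
  -- the covariance identity
  have hcov : ∀ U Y, Φ (configCrossTranslate i Y U) =
      ∑ mk, g mk (configCrossSplice i U Y) * conj (g mk (configLinkReflect i U)) := by
    intro U Y
    have hpt : ∀ a b, (τ (wordHolonomyZd (configCrossTranslate i Y U) p (E a b))).trace =
        ∑ m, ∑ k, σ (Gf b (configCrossSplice i U Y)) m k * conj (σ (Gf a (configLinkReflect i U)) m k) :=
      fun a b => trace_linkCutGlue_configCrossTranslate τ hτ hp hq U Y (hend a) (hend b)
        (hhalf a) (hhalf b)
    have hL : Φ (configCrossTranslate i Y U) = ∑ a, ∑ b, ∑ m, ∑ k, conj (c a) * c b *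
        (σ (Gf b (configCrossSplice i U Y)) m k * conj (σ (Gf a (configLinkReflect i U)) m k)) := by
      simp only [hΦ, hpt, Finset.mul_sum]
    have hR : ∑ mk : Fin M × Fin M, g mk (configCrossSplice i U Y) * conj (g mk (configLinkReflect i U)) =
        ∑ m, ∑ k, ∑ b, ∑ a, conj (c a) * c b *
          (σ (Gf b (configCrossSplice i U Y)) m k * conj (σ (Gf a (configLinkReflect i U)) m k)) := by
      rw [Fintype.sum_prod_type]
      refine Finset.sum_congr rfl fun m _ => Finset.sum_congr rfl fun k _ => ?_
      simp only [hg]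
      rw [map_sum, Finset.sum_mul]
      refine Finset.sum_congr rfl fun b _ => ?_
      rw [Finset.mul_sum]
      refine Finset.sum_congr rfl fun a _ => ?_
      rw [map_mul (starRingEnd ℂ) (c a) (σ (Gf a (configLinkReflect i U)) m k)]
      ring
    rw [hL, hR]
    refine Eq.trans (Finset.sum_congr rfl fun a _ => Finset.sum_comm) ?_
    refine Eq.trans Finset.sum_comm ?_
    refine Finset.sum_congr rfl fun m _ => ?_
    refine Eq.trans (Finset.sum_congr rfl fun a _ => Finset.sum_comm) ?_
    refine Eq.trans Finset.sum_comm ?_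
    exact Finset.sum_congr rfl fun k _ => Finset.sum_comm
  calc (0 : ℂ) ≤ ∫ U, Φ U ∂μ :=
    hμ.nonneg_of_fintype hTsub hgm hgT hgb hΦS hΦc hΦb hcov

/-- ★★★ **Cut-loop `R_link` blocks with loop-variable entries.** For a probability measure `μ` on
`ℤ^d` configurations with `IsCovariantLinkRP i μ`, continuous `ρ`, sites `p, q` of the layer
`x_i = 0`, half-words `O_a : p + e_i → q + e_i` (holonomies supported in `{x_i ≥ 1}`) and REAL
coefficients: `0 ≤ Σ_{ab} c_a c_b ∫ W_p([+e_i] · O_b · [-e_i] · (flip_i O_a)⁻¹) dμ`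
(`W = wordLoopZd ρ = (1/N) Re tr ρ`) — Kazakov–Zheng's link-type positivity matrix. -/
theorem rLinkCutWordBlock_nonneg (hρ : Continuous ρ) {μ : Measure (LGConfig d G)}
    [IsProbabilityMeasure μ] {i : Fin d} (hμ : IsCovariantLinkRP i μ) {p q : Fin d → ℤ}
    (hp : p i = 0) (hq : q i = 0) {n : ℕ} (O : Fin n → Word d)
    (hend : ∀ a, Word.endpointZd (p + Pi.single i 1) (O a) = q + Pi.single i 1)
    (hhalf : ∀ a, DependsOn (fun U : LGConfig d G => wordHolonomyZd U (p + Pi.single i 1) (O a))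
      (linkHalfEdges i))
    (c : Fin n → ℝ) :
    0 ≤ ∑ a, ∑ b, c a * c b * ∫ U, wordLoopZd ρ p
      (Step.fwd i :: (O b ++ Step.bwd i :: Word.reverse ((O a).map (Step.flipAt i)))) U ∂μ := by
  have h := sum_conj_mul_integral_trace_linkCutGlue_nonneg ρ hρ hμ hp hq O hend hhalf
    (fun a => (c a : ℂ))
  set w : Fin n → Fin n → Word d :=
    fun a b => Step.fwd i :: (O b ++ Step.bwd i :: Word.reverse ((O a).map (Step.flipAt i))) with hw
  have hE : ∀ a b, WilsonRP.EntryMeasurable ρ (fun U : LGConfig d G => wordHolonomyZd U p (w a b)) :=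
    fun a b => entryMeasurable_wordHolonomyZd ρ hρ (w a b) p
  have htm : ∀ a b, Measurable fun U : LGConfig d G => (ρ (wordHolonomyZd U p (w a b))).trace :=
    fun a b => by
    simp only [Matrix.trace, Matrix.diag_apply]
    exact Finset.measurable_sum _ fun k _ => hE a b k k
  have htb : ∀ (g : G), ‖(ρ g).trace‖ ≤ N := fun g => by
    rw [← CompactGroup.trace_unitarize ρ hρ g, Matrix.trace]
    calc ‖∑ k, Matrix.diag (CompactGroup.unitarize ρ hρ g) k‖
        ≤ ∑ k, ‖Matrix.diag (CompactGroup.unitarize ρ hρ g) k‖ := norm_sum_le _ _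
      _ ≤ ∑ _k : Fin N, (1 : ℝ) := Finset.sum_le_sum fun k _ => by
          rw [Matrix.diag_apply]; exact CompactGroup.norm_unitarize_apply_le_one ρ hρ g k k
      _ = N := by simp
  have hti : ∀ a b, Integrable (fun U : LGConfig d G => (ρ (wordHolonomyZd U p (w a b))).trace) μ :=
    fun a b => Integrable.of_bound (htm a b).aestronglyMeasurable (N : ℝ) (ae_of_all _ fun U => htb _)
  have hW : ∀ a b, ∫ U, wordLoopZd ρ p (w a b) U ∂μ =
      (N : ℝ)⁻¹ * (∫ U, (ρ (wordHolonomyZd U p (w a b))).trace ∂μ).re := fun a b => by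
    simp only [wordLoopZd_apply]
    rw [integral_const_mul]
    have hre := integral_re (hti a b)
    simp only [RCLike.re_to_complex] at hre
    rw [hre]
  have key : ∑ a, ∑ b, c a * c b * ∫ U, wordLoopZd ρ p (w a b) U ∂μ =
      (N : ℝ)⁻¹ * (∑ a, ∑ b, conj (c a : ℂ) * (c b : ℂ) *
        ∫ U, (ρ (wordHolonomyZd U p (w a b))).trace ∂μ).re := by
    rw [Complex.re_sum, Finset.mul_sum]
    refine Finset.sum_congr rfl fun a _ => ?_
    rw [Complex.re_sum, Finset.mul_sum]
    refine Finset.sum_congr rfl fun b _ => ?_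
    rw [hW, Complex.conj_ofReal, mul_assoc (c a : ℂ), Complex.re_ofReal_mul, Complex.re_ofReal_mul]
    ring
  rw [key]
  exact mul_nonneg (inv_nonneg.2 (Nat.cast_nonneg N)) (Complex.nonneg_iff.1 h).1

end Blocks

end

end Summit.QuantumFields.GaugeBoot
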